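import Literature.NumberTheory.EllipticCurves.TowerLiftableConnectingProofs
import Literature.NumberTheory.EllipticCurves.ZpExtensionEisensteinBottomConjugationProofs
import Literature.NumberTheory.EllipticCurves.ZpExtensionEisensteinSelmerCartesianProofs
import Literature.NumberTheory.EllipticCurves.ZpExtensionEisensteinSelmerStructure
import Literature.NumberTheory.GaloisRepresentations.ConnectingMapTopGradedPieceProofs
import Literature.NumberTheory.GaloisCohomology.Howard2004.PropagateUnramifiedProofs
import HarnessLib

/-!
# The residual image of Howard's `F_𝔮` at a place of `S` away from `p` is the kernel `ker (H¹(K_v, T̄) → H¹(K_v, W₁))`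
# of the top graded piece (theorems only)

`Proofs` file (theorems only; no definition, no named fact, no instance, no `sorry`).  Topic `NumberTheory/EllipticCurves`
(D1 road of cell `pub/bsd-print-x9`; Howard's hypothesis **H.5(b)** for the Eisenstein specialisation at the places of `S`,
memo `HOME/x9-p1-w3/H5B-AT-S-PLAN-w3g5.md`, step (A2)).

For the Eisenstein tower `W_j = M_j ⊗ A_{m,j}(ψ)` (x9-p1-w3's two-index family `ZpExtension.eisensteinTwistTransfer`) and a
residual presentation `π̄ : W₁ ↠ T̄` (`Howard2004.IsQuotientBy` by the maximal ideal `([T])` of `A_{m,1}`, `T̄` carrying the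
residue-character module structure), Howard's condition `F_𝔮` at a finite place `w ∈ S` with `w ∤ p` is the level condition of
the saturated UNRAMIFIED tower (`eisensteinSelmerStructure_inr_of_mem_of_not_mem`).  If the local tower at `w` is UNIFORMLY
TORSION (`p^c • H¹(K_w, W_j) = 0`, D1's (hTX)) and its local invariants are killed by `[T]^{m-1}` ((SB), from the
Cayley–Hamilton bound for `m` large), then the condition PROPAGATED TO `T̄`,

  `F̄_𝔮(w) = π̄_* F_𝔮(w) = ker ( H¹(K_w, T̄) →H¹(j) H¹(K_w, W₁) )`,   `j ∘ π̄ = [T]^{m-1} •`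

(**`ZpExtension.propagate_eisensteinSelmerStructure_one_eq_ker`**): by `Tower.mem_levelCondition_one_iff_exists_δ₀` the
liftable classes are the connecting classes `δ₀^{(1,1)} u` of `0 → W₁ → W₂ → W₁ → 0` on the `[T]^{m-1}`-torsion invariants, and
by `DiscreteGaloisModule.image_map_δ₀_eq_ker_map` their `π̄`-image is `ker H¹(j)`.  §1 supplies the map `j : T̄ → W₁`
through which `[T]^{m-1}` factors (`DiscreteGaloisModule.exists_intertwining_apply_eq_smul`, any surjective presentation).

No summit statement is proved; BSD is not proved by any of this.  Seat `bsd-line-x9-p1-w3` g5.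

References: [Howard2004HeegnerKolyvagin] §1.3 H.5(b), Def. 3.1.2, §2.2 (arXiv:1202.6340 p. 7 L96–97, p. 15);
[SerreGaloisCohomology1997] I §2.2; [MazurRubinMemoirs2004] Def. 1.1.1, Example 1.1.2.
-/

noncomputable section

open scoped TensorProduct ContRepresentation
open Function Field IsDedekindDomain

namespace Literature.NumberTheory.EllipticCurves

open Literature.NumberTheory.GaloisRepresentations IwasawaAlgebra
open Literature.NumberTheory.GaloisCohomology.Howard2004
open scoped NumberField

/-! ## §1 Factoring a scalar through a surjective presentation -/

namespace DiscreteGaloisModule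

variable {F : Type} [Field F] {R : Type} [CommRing R]
  {V : Type} [AddCommGroup V] [TopologicalSpace V] [DiscreteTopology V] [Module R V]
  {N : Type} [AddCommGroup N] [TopologicalSpace N] [DiscreteTopology N]
  {ρ : DiscreteGaloisModule F V} {ρN : DiscreteGaloisModule F N}

/-- **Factoring a scalar through a presentation.**  For an `R`-linear discrete module `V`, an equivariant additive
SURJECTION `π : V ↠ N` and a scalar `r` killing `ker π`, there is a (unique) continuous equivariant `j : N → V` with
`j (π x) = r • x` — the injective morphism `T/IT ↪ T` of Howard's `Quot(T)` induced by `r` with `r I = 0` (here: `×[T]^{m-1} :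
T̄ = W₁/[T]W₁ ↪ W₁`). [cite: Howard2004HeegnerKolyvagin, Def. 1.1.3 (arXiv Def. 2.1.3: morphisms of Quot(T) induced by scalars)] -/
theorem exists_intertwining_apply_eq_smul (hlin : ρ.IsScalarLinear R) (π : V →+ N) (hπ : Function.Surjective π)
    (hequiv : ∀ (g : absoluteGaloisGroup F) (x : V), π (ρ g x) = ρN g (π x)) (r : R) (hr : ∀ x, π x = 0 → r • x = 0) :
    ∃ j : ρN.toContRepresentation →ⁱL ρ.toContRepresentation, ∀ x, j (π x) = r • x := by
  have key : ∀ x y : V, π x = π y → r • x = r • y := fun x y hxy ↦ by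
    rw [← sub_eq_zero, ← smul_sub]
    exact hr _ (by rw [map_sub, hxy, sub_self])
  let j₀ : N →+ V := AddMonoidHom.mk' (fun y ↦ r • surjInv hπ y) fun y y' ↦ by
    rw [← smul_add]
    exact key _ _ (by rw [map_add, surjInv_eq hπ, surjInv_eq hπ, surjInv_eq hπ])
  have hj₀ : ∀ (g : absoluteGaloisGroup F) (y : N), j₀ (ρN g y) = ρ g (j₀ y) := fun g y ↦ by
    change r • surjInv hπ (ρN g y) = ρ g (r • surjInv hπ y)
    rw [hlin]
    exact key _ _ (by rw [surjInv_eq hπ, hequiv, surjInv_eq hπ])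
  exact ⟨{ toContinuousLinearMap := ⟨j₀.toIntLinearMap, continuous_of_discreteTopology⟩
           isIntertwining' := fun g ↦ ContinuousLinearMap.ext fun y ↦ hj₀ g y },
    fun x ↦ key _ _ (surjInv_eq hπ _)⟩

end DiscreteGaloisModule

/-! ## §2 The residual image at a place of `S` away from `p` -/

namespace ZpExtension

variable {K : Type} [Field K] [NumberField K] {p : ℕ} [hp : Fact p.Prime] (κ : ZpExtension K p)
  {M : ℕ → Type} [∀ k, AddCommGroup (M k)] [∀ k, TopologicalSpace (M k)] [∀ k, DiscreteTopology (M k)]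
  (ρ : ∀ k, DiscreteGaloisModule K (M k))
  (t : ∀ k, (ρ (k + 1)).toContRepresentation →ⁱL (ρ k).toContRepresentation) {m : ℕ} (hm : 1 ≤ m)

set_option maxHeartbeats 800000 in
/-- **The residual image of `F_𝔮` at `w ∈ S`, `w ∤ p`, is `ker H¹(K_w, j)`.**  Generic Eisenstein tower (`ht/hkt/hkill`,
coordinates `e`), residual presentation `π̄ : W₁ ↠ T̄` by `([T])` with `T̄` an `A_{m,1}`-module through the residue character,
an equivariant `j : T̄ → W₁` with `j ∘ π̄ = [T]^{m-1} •`; hypotheses at `w`: uniform torsion `p^c • H¹(K_w, W_j) = 0` and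
`[T]^{m-1}` kills the `Γ_{K_w}`-invariants of every `W_j`.  Then
`(F_𝔮 propagated to T̄)(w) = ker (H¹(K_w, T̄) → H¹(K_w, W₁))`.
[cite: Howard2004HeegnerKolyvagin, §1.3 H.5(b) and Def. 3.1.2 (arXiv:1202.6340 p. 7 L96–97, p. 15 L99–108)]
[cite: MazurRubinMemoirs2004, Def. 1.1.1 and Example 1.1.2] [cite: SerreGaloisCohomology1997, Ch. I §2.2] -/
theorem propagate_eisensteinSelmerStructure_one_eq_ker (ht : ∀ k, Function.Surjective (t k))
    (hkt : ∀ k (x : M (k + 1)), t k x = 0 ↔ ∃ y : M (k + 1), x = ((p : ℤ) ^ k) • y)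
    (hkill : ∀ k (x : M k), ((p : ℤ) ^ k) • x = 0) {ι : ℕ → Type} [∀ k, Fintype (ι k)]
    (e : ∀ k, M k ≃+ (ι k → ZMod (p ^ k)))
    (S : Finset (HeightOneSpectrum (𝓞 K)))
    (Φ : ∀ v : HeightOneSpectrum (𝓞 K), ((p : ℕ) : 𝓞 K) ∈ v.asIdeal → OrdinaryFiltration ρ t v)
    {N : Type} [AddCommGroup N] [TopologicalSpace N] [DiscreteTopology N] [Module (EisensteinCoeff p m 1) N]
    (hN : ∀ (c : EisensteinCoeff p m 1) (n : N), c • n = (EisensteinCoeff.residueChar p hm (le_refl 1) c).val • n)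
    (ρN : DiscreteGaloisModule K N) (πbar : EisensteinCoeff.Twisted p m 1 (M 1) →ₗ[EisensteinCoeff p m 1] N)
    (hbar : IsQuotientBy (κ.eisensteinTwist (ρ 1) hm 1)
      (@IsLocalRing.maximalIdeal _ _ (EisensteinCoeff.isLocalRing_eisensteinCoeff p hm (le_refl 1))) ρN πbar)
    (jg : ρN.toContRepresentation →ⁱL (κ.eisensteinTwist (ρ 1) hm 1).toContRepresentation)
    (hjg : ∀ x, jg (πbar x) = ((Ideal.Quotient.mk _ PowerSeries.X : EisensteinCoeff p m 1) ^ (m - 1)) • x)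
    (w : HeightOneSpectrum (𝓞 K)) (hw : ((p : ℕ) : 𝓞 K) ∉ w.asIdeal) (hwS : w ∈ S)
    {c : ℕ} (hUT : ∀ (j : ℕ) (y : galoisCohomology ((κ.eisensteinTwist (ρ j) hm j).toLocal (Sum.inr w)) 1), p ^ c • y = 0)
    (hSB : ∀ (j : ℕ) (v : EisensteinCoeff.Twisted p m j (M j)),
      (∀ g : absoluteGaloisGroup (w.adicCompletion K), ((κ.eisensteinTwist (ρ j) hm j).toLocal (Sum.inr w)) g v = v) →
        ((Ideal.Quotient.mk _ PowerSeries.X : EisensteinCoeff p m j) ^ (m - 1)) • v = 0) :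
    hbar.propagateStructure (κ.eisensteinSelmerStructure ρ t hm S Φ 1) (Sum.inr w) =
      (galoisCohomology.map (DiscreteGaloisModule.localMap jg (Sum.inr w)) 1).ker := by
  -- the two-index family, localised at `w`, and its identities
  let Fam : ∀ a b, (κ.eisensteinTwist (ρ a) hm a).toContRepresentation →ⁱL (κ.eisensteinTwist (ρ b) hm b).toContRepresentation :=
    fun a b ↦ κ.eisensteinTwistTransfer ρ t hm ht hkt hkill a b
  let ρloc : ∀ j, DiscreteGaloisModule (w.adicCompletion K) (EisensteinLevel p m M j) :=
    fun j ↦ ((κ.eisensteinTwist (ρ j) hm j : DiscreteGaloisModule K (EisensteinLevel p m M j))).toLocal (Sum.inr w)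
  let floc : ∀ a b, (ρloc a).toContRepresentation →ⁱL (ρloc b).toContRepresentation :=
    fun a b ↦ DiscreteGaloisModule.localMap (Fam a b) (Sum.inr w)
  have hid : ∀ a (x : EisensteinLevel p m M a), floc a a x = x := fun a x ↦ κ.eisensteinTwistTransfer_self ρ t hm ht hkt hkill a x
  have hcomp : ∀ a b c', c' ≤ b → b ≤ a → ∀ x : EisensteinLevel p m M a, floc b c' (floc a b x) = floc a c' x :=
    fun a b c' hcb hba x ↦ κ.eisensteinTwistTransfer_comp ρ t hm ht hkt hkill hcb hba x
  have hsq : ∀ a b, a ≤ b → ∀ x : EisensteinLevel p m M (a + 1), floc a b (floc (a + 1) a x) = floc (b + 1) b (floc (a + 1) (b + 1) x) :=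
    fun a b hab x ↦ κ.eisensteinTwistTransfer_sq ρ t hm ht hkt hkill hab x
  have hinj : ∀ ℓ n, Function.Injective (floc ℓ (ℓ + n)) :=
    fun ℓ n ↦ κ.eisensteinTwistTransfer_injective_of_le ρ t hm ht hkt hkill e ℓ n
  have hsurj : ∀ ℓ n, Function.Surjective (floc (ℓ + n) n) :=
    fun ℓ n ↦ κ.eisensteinTwistTransfer_surjective_of_le ρ t hm ht hkt hkill (Nat.le_add_left n ℓ)
  have hex : ∀ ℓ n (y : EisensteinLevel p m M (ℓ + n)), floc (ℓ + n) n y = 0 ↔ ∃ x, floc ℓ (ℓ + n) x = y :=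
    fun ℓ n y ↦ κ.eisensteinTwistTransfer_eq_zero_iff_exists ρ t hm ht hkt hkill ℓ n y
  have hpow : ∀ ℓ n (x : EisensteinLevel p m M (ℓ + n)), floc ℓ (ℓ + n) (floc (ℓ + n) ℓ x) = p ^ n • x :=
    fun ℓ n x ↦ κ.eisensteinTwistTransfer_apply_apply_of_le ρ t hm ht hkt hkill ℓ n x
  have hkill' : ∀ j (x : EisensteinLevel p m M j), p ^ j • x = 0 := fun j x ↦ EisensteinCoeff.prime_pow_nsmul_twisted x
  -- D1's local tower is `H¹(floc (j+1) j)`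
  have hred : κ.eisensteinLocalReduce ρ t hm (Sum.inr w) = fun j ↦ galoisCohomology.map (floc (j + 1) j) 1 := by
    funext j
    change _ = galoisCohomology.map (DiscreteGaloisModule.localMap (κ.eisensteinTwistTransfer ρ t hm ht hkt hkill (j + 1) j) (Sum.inr w)) 1
    rw [κ.eisensteinTwistTransfer_succ_self ρ t hm ht hkt hkill j]
    rfl
  -- scalar bookkeeping on the levels
  have hX1m : (Ideal.Quotient.mk _ PowerSeries.X : EisensteinCoeff p m 1) ^ m = 0 := EisensteinCoeff.mk_X_pow_eq_zero p m
  have hXp : ∀ j, (Ideal.Quotient.mk _ PowerSeries.X : EisensteinCoeff p m j) ^ m = -(p : EisensteinCoeff p m j) := by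
    intro j
    rw [← map_pow, ← map_natCast (Ideal.Quotient.mk _), ← map_neg, Ideal.Quotient.eq,
      ← map_natCast (PowerSeries.C (R := ℤ_[p])) p, sub_neg_eq_add]
    exact Ideal.mem_sup_left (Ideal.mem_span_singleton_self _)
  -- reduction-semilinearity of the downward maps and of the upward maps
  have hdown : ∀ {a b : ℕ} (hba : b ≤ a) (d : EisensteinCoeff p m a) (x : EisensteinLevel p m M a),
      floc a b (d • x) = EisensteinCoeff.reduce p m hba d • floc a b x := by
    intro a b hba d x
    change κ.eisensteinTwistTransfer ρ t hm ht hkt hkill a b (d • x) = _ • κ.eisensteinTwistTransfer ρ t hm ht hkt hkill a b x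
    rw [κ.eisensteinTwistTransfer_of_le ρ t hm ht hkt hkill hba]
    exact κ.eisensteinTwistReduce_smul hm hba _ d x
  have hup : ∀ {a b : ℕ} (hab : a ≤ b) (d : EisensteinCoeff p m b) (x : EisensteinLevel p m M a),
      floc a b (EisensteinCoeff.reduce p m hab d • x) = d • floc a b x := by
    intro a b hab d x
    obtain ⟨y, rfl⟩ := Tower.surjective_of_le ρloc floc hsurj hab x
    rw [← hdown hab d y, Tower.apply_down_up_eq_pow_smul ρloc floc p hpow hab,
      Tower.apply_down_up_eq_pow_smul ρloc floc p hpow hab, smul_comm]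
  -- the data of the one-place lemma at the bottom
  let X₁ : EisensteinCoeff p m 1 := Ideal.Quotient.mk _ PowerSeries.X
  let X₂ : EisensteinCoeff p m (1 + 1) := Ideal.Quotient.mk _ PowerSeries.X
  have hlin : ∀ j, (ρloc j).IsScalarLinear (EisensteinCoeff p m j) := fun j g d x ↦
    κ.eisensteinTwist_apply_smul (ρ j) hm j _ d x
  let T₁ := DiscreteGaloisModule.scalarIntertwining (ρloc 1) (hlin 1) X₁
  let θ₁ := DiscreteGaloisModule.scalarIntertwining (ρloc 1) (hlin 1) (X₁ ^ (m - 1))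
  let T₂ := DiscreteGaloisModule.scalarIntertwining (ρloc (1 + 1)) (hlin (1 + 1)) X₂
  let θ₂ := DiscreteGaloisModule.scalarIntertwining (ρloc (1 + 1)) (hlin (1 + 1)) (X₂ ^ (m - 1))
  let πloc : (ρloc 1).toContRepresentation →ⁱL (ρN.toLocal (Sum.inr w)).toContRepresentation :=
    { toContinuousLinearMap := ⟨πbar.toAddMonoidHom.toIntLinearMap, continuous_of_discreteTopology⟩
      isIntertwining' := fun g ↦ ContinuousLinearMap.ext fun x ↦ hbar.equivariant _ x }
  let jloc := DiscreteGaloisModule.localMap jg (Sum.inr w)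
  have hred12 : EisensteinCoeff.reduce p m (Nat.le_succ 1) X₂ = X₁ := EisensteinCoeff.reduce_mk m (Nat.le_succ 1) _
  have hπX : ∀ x, πbar (X₁ • x) = 0 := fun x ↦ by
    rw [map_smul, hN, EisensteinCoeff.residueChar_mk_X, ZMod.val_zero, zero_smul]
  have hkerθ : ∀ x : EisensteinLevel p m M 1, θ₁ x = 0 → ∃ w', T₁ w' = x := fun x hx ↦ by
    obtain ⟨y, hy⟩ := EisensteinCoeff.Twisted.exists_eq_mk_X_smul_of_pow_pred_smul_eq_zero hm (e 1) x hx
    exact ⟨y, hy.symm⟩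
  have hj : Function.Injective jloc := by
    refine (injective_iff_map_eq_zero _).mpr fun n hn ↦ ?_
    obtain ⟨x, rfl⟩ := hbar.surjective n
    change jg (πbar x) = 0 at hn
    rw [hjg] at hn
    obtain ⟨y, rfl⟩ := EisensteinCoeff.Twisted.exists_eq_mk_X_smul_of_pow_pred_smul_eq_zero hm (e 1) x hn
    exact hπX y
  -- §A: the level condition at `w` is the set of connecting classes of small invariants (L1)
  have hc1 : 1 ≤ c + 1 := Nat.le_add_left 1 c
  have hUT' : ∀ y : galoisCohomology (ρloc (1 + (c + 1))) 1, p ^ (c + 1) • y = 0 := fun y ↦ by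
    have h : p ^ c • y = (0 : galoisCohomology (ρloc (1 + (c + 1))) 1) := hUT (1 + (c + 1)) y
    rw [pow_succ', mul_smul, h, smul_zero]
  have hSB' : ∀ v : EisensteinLevel p m M (c + 1), v ∈ (ρloc (c + 1)).toTopRep.ρ.invariants →
      ∃ u : EisensteinLevel p m M 1, θ₁ u = 0 ∧ floc 1 (c + 1) u = v := by
    intro v hv
    have hXv : ((Ideal.Quotient.mk _ PowerSeries.X : EisensteinCoeff p m (c + 1)) ^ (m - 1)) • v = 0 :=
      hSB (c + 1) v (fun g ↦ hv g)
    -- `p • v = 0`, so `v = p^c • v'`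
    have hXm : (Ideal.Quotient.mk _ PowerSeries.X : EisensteinCoeff p m (c + 1)) ^ m =
        Ideal.Quotient.mk _ PowerSeries.X * (Ideal.Quotient.mk _ PowerSeries.X) ^ (m - 1) := by
      rw [← pow_succ', Nat.sub_add_cancel hm]
    have hpv : p ^ 1 • v = 0 := by
      rw [pow_one, ← Nat.cast_smul_eq_nsmul (EisensteinCoeff p m (c + 1)), ← neg_neg ((p : EisensteinCoeff p m (c + 1))),
        ← hXp, neg_smul, hXm, mul_smul, hXv, smul_zero, neg_zero]
    obtain ⟨v', rfl⟩ := EisensteinCoeff.Twisted.exists_eq_pow_smul_of_pow_smul_eq_zero hm hc1 (e (c + 1)) v hpv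
    refine ⟨floc (c + 1) 1 v', ?_, (Tower.apply_down_up_eq_pow_smul ρloc floc p hpow hc1 v').trans
      (congrArg (fun n ↦ p ^ n • v') (Nat.add_sub_cancel c 1))⟩
    -- `[T]^{m-1} u = 0` by injectivity of the upward map
    apply Tower.injective_of_le ρloc floc hinj hc1
    change floc 1 (c + 1) ((X₁ ^ (m - 1)) • floc (c + 1) 1 v') = floc 1 (c + 1) 0
    have hredc : EisensteinCoeff.reduce p m hc1 ((Ideal.Quotient.mk _ PowerSeries.X : EisensteinCoeff p m (c + 1)) ^ (m - 1)) =
        X₁ ^ (m - 1) := by rw [map_pow, EisensteinCoeff.reduce_mk m hc1]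
    rw [map_zero, ← hredc, hup hc1, Tower.apply_down_up_eq_pow_smul ρloc floc p hpow hc1, Nat.add_sub_cancel]
    exact hXv
  -- §B: the hypotheses of the one-place lemma (L2′)
  have hι : Function.Injective (floc 1 (1 + 1)) := Tower.injective_of_le ρloc floc hinj (Nat.le_succ 1)
  have hr : Function.Surjective (floc (1 + 1) 1) := hsurj 1 1
  have hιr : ∀ y, floc (1 + 1) 1 y = 0 ↔ ∃ x, floc 1 (1 + 1) x = y := hex 1 1
  have hrT : ∀ y, floc (1 + 1) 1 (T₂ y) = T₁ (floc (1 + 1) 1 y) := fun y ↦ by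
    change floc (1 + 1) 1 (X₂ • y) = X₁ • floc (1 + 1) 1 y
    rw [hdown (Nat.le_succ 1), hred12]
  have hιθ : ∀ x, floc 1 (1 + 1) (θ₁ x) = θ₂ (floc 1 (1 + 1) x) := fun x ↦ by
    change floc 1 (1 + 1) ((X₁ ^ (m - 1)) • x) = (X₂ ^ (m - 1)) • floc 1 (1 + 1) x
    rw [show X₁ ^ (m - 1) = EisensteinCoeff.reduce p m (Nat.le_succ 1) (X₂ ^ (m - 1)) by
      rw [map_pow (EisensteinCoeff.reduce p m (Nat.le_succ 1)), hred12], hup (Nat.le_succ 1)]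
  have hθT : ∀ y, θ₂ (T₂ y) = -(floc 1 (1 + 1) (floc (1 + 1) 1 y)) := fun y ↦ by
    change (X₂ ^ (m - 1)) • X₂ • y = -(floc 1 (1 + 1) (floc (1 + 1) 1 y))
    have hXm2 : X₂ ^ (m - 1) * X₂ = X₂ ^ m := by rw [← pow_succ, Nat.sub_add_cancel hm]
    rw [hpow 1 1 y, smul_smul, hXm2, hXp, neg_smul, pow_one, Nat.cast_smul_eq_nsmul]
  have hjπ : ∀ x, jloc (πloc x) = θ₁ x := fun x ↦ hjg x
  have hTj : ∀ n, T₁ (jloc n) = 0 := fun n ↦ by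
    obtain ⟨x, rfl⟩ := hbar.surjective n
    change X₁ • jg (πbar x) = 0
    have hXm1 : X₁ * X₁ ^ (m - 1) = X₁ ^ m := by rw [← pow_succ', Nat.sub_add_cancel hm]
    rw [hjg, smul_smul, hXm1, hX1m, zero_smul]
  have hπT : ∀ x, πloc (T₁ x) = 0 := fun x ↦ hπX x
  -- §C: assemble
  have hb : hbar.localCohomologyMap (Sum.inr w) 1 = galoisCohomology.map πloc 1 :=
    cohomologyMap_one_eq_map (ρloc 1) (ρN.toLocal (Sum.inr w)) πbar.toAddMonoidHom continuous_of_discreteTopology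
      (fun _ x ↦ hbar.equivariant _ x) πloc fun _ ↦ rfl
  have hcond : κ.eisensteinSelmerStructure ρ t hm S Φ 1 (Sum.inr w) =
      Tower.levelCondition (H := fun j ↦ galoisCohomology (ρloc j) 1) (fun j ↦ galoisCohomology.map (floc (j + 1) j) 1) p
        (fun j ↦ DiscreteGaloisModule.unramifiedSubgroup (GaloisRep.toLocal w (κ.eisensteinTwist (ρ j) hm j)) 1) 1 := by
    rw [κ.eisensteinSelmerStructure_inr_of_mem_of_not_mem ρ t hm S Φ 1 hw hwS, hred]
    rfl
  rw [IsQuotientBy.propagateStructure_apply, hb, hcond]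
  ext y
  rw [AddSubgroup.mem_map, AddMonoidHom.mem_ker]
  have key := DiscreteGaloisModule.image_map_δ₀_eq_ker_map (floc 1 (1 + 1)) (floc (1 + 1) 1) jloc πloc T₁ θ₁ T₂ θ₂
    hι hr hιr hj hrT hιθ hθT hjπ hTj hπT hkerθ
  constructor
  · rintro ⟨z, hz, rfl⟩
    obtain ⟨u, hPu, hu⟩ := (Tower.mem_levelCondition_one_iff_exists_δ₀ ρloc floc hid hcomp hsq hinj hsurj hex p hpow hkill'
      hc1 hUT' (fun u ↦ θ₁ u = 0) hSB' _ z).mp hz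
    have hmem : galoisCohomology.map πloc 1 z ∈ (galoisCohomology.map πloc 1) ''
        {y | ∃ w' : (ρloc 1).toTopRep.ρ.invariants, θ₁ (w' : EisensteinLevel p m M 1) = 0 ∧
          (DiscreteGaloisModule.isSES_ofHom (floc 1 (1 + 1)) (floc (1 + 1) 1) hι hr hιr).δ₀ w' = y} :=
      ⟨z, ⟨u, hPu, hu⟩, rfl⟩
    rw [key] at hmem
    exact hmem
  · intro hy
    have hmem : y ∈ (galoisCohomology.map πloc 1) ''
        {y | ∃ w' : (ρloc 1).toTopRep.ρ.invariants, θ₁ (w' : EisensteinLevel p m M 1) = 0 ∧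
          (DiscreteGaloisModule.isSES_ofHom (floc 1 (1 + 1)) (floc (1 + 1) 1) hι hr hιr).δ₀ w' = y} := by
      rw [key]; exact hy
    obtain ⟨z, ⟨u, hPu, hu⟩, rfl⟩ := hmem
    exact ⟨z, (Tower.mem_levelCondition_one_iff_exists_δ₀ ρloc floc hid hcomp hsq hinj hsurj hex p hpow hkill'
      hc1 hUT' (fun u ↦ θ₁ u = 0) hSB' _ z).mpr ⟨u, hPu, hu⟩, rfl⟩

end ZpExtension

end Literature.NumberTheory.EllipticCurves

end
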